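import Literature.Probability.LatticeModels.HalfPlanePoissonKernel
import Mathlib.Analysis.SpecialFunctions.Integrals.Basic
import Summits.CriticalPhenomena.CardyFormulaZ2.Theorems.CardyBoundaryCoulombGasBoundaryDefectGaussianRStubClusterLocalityV2Part1

/-!
# Stub `stub_clusterLocalityV2` of line `rainbow-monomials-in-excursion-kernels` — Part 2:
# the half-plane Poisson kernel is `O(1/height)` everywhere, and comparison of the Dirichlet
# Green function at a boundary-row point with the half-plane kernel
# (crux `BoundaryDefectGaussianR`, stmt-CriticalPhenomena-14132)

Two inputs of the Green-locality half G1 of `stub_clusterLocalityV2`.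

* **(K) Uniform decay of the half-plane Poisson kernel in the height**: the tree's
  `hpK s m = (1/π) ∫₀^π cos(mθ) ρ(θ)^s dθ` (`HalfPlanePoissonKernel.lean`; the bounded harmonic
  function of the discrete upper half-plane with boundary values `δ₀` on the row `-1`, read at
  `(m, s-1)`) satisfies `hpK s m ≤ 2/s` for `s ≥ 1` and ALL `m` (`hpK_le_two_div`), complementing
  the tree's `hpK s m ≤ 2s/(π m²)` (`m ≠ 0`) and `hpK s 0 ≥ 1/(4s)`. Proof: the mode is bounded by
  a rational function, `ρ(θ) ≤ π/(π + 2θ)` on `[0, π]` (`hpMode_le_pi_div`, from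
  `1 - cos θ ≥ 2θ²/π²`), the second-order Bernoulli inequality gives
  `ρ^s ≤ π²/(2s(s-1)θ²)`, and `∫₀^π ρ^s ≤ π/s + ∫_{π/s}^π π²/(2s(s-1)θ²) dθ ≤ 2π/s`.
* **(P) Comparison with the half-plane kernel.** For a finite `Λ` contained in the rows
  `{v₁ ≥ r}` and a point `p ∈ Λ` of the row `r`, the Green function with pole `p` is the
  harmonic measure of the outer vertex `p̂ = p - e₂` below `p` (`dirichletGreen_eq_poissonKernel_below`),
  hence is dominated by the half-plane Poisson kernel with pole `p̂`,
  `G_Λ(v, p) ≤ hpPoisson(v - p̂ - e₂)` (`dirichletGreen_le_hpPoisson`), and dominates it up to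
  the kernel's maximum over the far part of `∂Λ`,
  `G_Λ(v, p) ≥ hpPoisson(v - p̂ - e₂) - B` if `hpPoisson ≤ B` on `∂Λ ∩ {v₁ ≥ r}`
  (`hpPoisson_sub_le_dirichletGreen`) — maximum principle for the harmonic function
  `hpPoisson - (G_Λ(·,p) + 1_{p̂})` on `Λ`.

All statements are folklore (Lawler–Limic 2010, §6.2, §8.1).
-/

noncomputable section

namespace Summit.CriticalPhenomena.CardyFormulaZ2.Cruxes.BoundaryDefectGaussianR.RainbowMonomialsInExcursionKernels

open Finset Real Set MeasureTheory intervalIntegral Literature.Probability.LatticeModels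

/-! ### (K) The mode is bounded by a rational function; the kernel is `O(1/s)` -/

/-- **`ρ(θ) ≤ π/(π + 2θ)` on `[0, π]`**: `ρ⁻¹ = c + √(c² - 1)` with `c = 2 - cos θ ≥ 1` and
`c² - 1 ≥ 2(c - 1) = 2(1 - cos θ) ≥ 4θ²/π²` (`Real.cos_le_one_sub_mul_cos_sq`). [folklore] -/
theorem hpMode_le_pi_div {θ : ℝ} (h0 : 0 ≤ θ) (hπ : θ ≤ π) : hpMode θ ≤ π / (π + 2 * θ) := by
  have hpi := Real.pi_pos
  have hc1 := one_le_hpC θ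
  have hcos : Real.cos θ ≤ 1 - 2 / π ^ 2 * θ ^ 2 :=
    Real.cos_le_one_sub_mul_cos_sq (by rw [abs_of_nonneg h0]; exact hπ)
  have hcm1 : 2 / π ^ 2 * θ ^ 2 ≤ hpC θ - 1 := by unfold hpC; linarith
  have hsq : (2 * θ / π) ^ 2 ≤ hpC θ ^ 2 - 1 := by
    have e : (2 * θ / π) ^ 2 = 2 * (2 / π ^ 2 * θ ^ 2) := by ring
    rw [e]
    nlinarith
  have hroot : 2 * θ / π ≤ Real.sqrt (hpC θ ^ 2 - 1) := by
    rw [Real.le_sqrt (by positivity) (hpC_sq_sub_one_nonneg θ)]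
    exact hsq
  rw [hpMode_eq_inv]
  have hden : 0 < π + 2 * θ := by positivity
  have hkey : (π + 2 * θ) / π ≤ hpC θ + Real.sqrt (hpC θ ^ 2 - 1) := by
    have e : (π + 2 * θ) / π = 1 + 2 * θ / π := by field_simp
    rw [e]; linarith
  calc (hpC θ + Real.sqrt (hpC θ ^ 2 - 1))⁻¹ ≤ ((π + 2 * θ) / π)⁻¹ :=
        inv_anti₀ (by positivity) hkey
    _ = π / (π + 2 * θ) := by rw [inv_div]

/-- **Second-order Bernoulli inequality**: `1 + s u + s(s-1)/2 · u² ≤ (1 + u)^s` for `u ≥ 0`.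
[folklore] -/
theorem one_add_mul_add_sq_le_pow {u : ℝ} (hu : 0 ≤ u) (s : ℕ) :
    1 + (s : ℝ) * u + (s : ℝ) * ((s : ℝ) - 1) / 2 * u ^ 2 ≤ (1 + u) ^ s := by
  induction s with
  | zero => simp
  | succ s ih =>
    have hu3 : 0 ≤ (s : ℝ) * ((s : ℝ) - 1) / 2 * u ^ 3 := by
      have hs : 0 ≤ (s : ℝ) * ((s : ℝ) - 1) := by
        rcases Nat.eq_zero_or_pos s with rfl | hs
        · simp
        · have : (1 : ℝ) ≤ s := by exact_mod_cast hs
          nlinarith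
      positivity
    have h1u : 0 ≤ 1 + u := by linarith
    calc 1 + ((s + 1 : ℕ) : ℝ) * u + ((s + 1 : ℕ) : ℝ) * (((s + 1 : ℕ) : ℝ) - 1) / 2 * u ^ 2
        ≤ (1 + (s : ℝ) * u + (s : ℝ) * ((s : ℝ) - 1) / 2 * u ^ 2) * (1 + u) := by
          push_cast; nlinarith
      _ ≤ (1 + u) ^ s * (1 + u) := mul_le_mul_of_nonneg_right ih h1u
      _ = (1 + u) ^ (s + 1) := (pow_succ _ _).symm

/-- For `s ≥ 2` and `0 < θ ≤ π`: `ρ(θ)^s ≤ π²/(2s(s-1)) · θ⁻²`. [folklore] -/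
theorem hpMode_pow_le_div_sq {θ : ℝ} (h0 : 0 < θ) (hπ : θ ≤ π) {s : ℕ} (hs : 2 ≤ s) :
    hpMode θ ^ s ≤ π ^ 2 / (2 * (s : ℝ) * ((s : ℝ) - 1)) * (θ ^ 2)⁻¹ := by
  have hpi := Real.pi_pos
  have hs2 : (2 : ℝ) ≤ s := by exact_mod_cast hs
  set u : ℝ := 2 * θ / π with hudef
  have hu : 0 < u := by positivity
  have h1 : hpMode θ ^ s ≤ (π / (π + 2 * θ)) ^ s :=
    pow_le_pow_left₀ (hpMode_pos θ).le (hpMode_le_pi_div h0.le hπ) s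
  have h2 : (π / (π + 2 * θ)) ^ s = ((1 + u) ^ s)⁻¹ := by
    rw [← inv_pow, hudef, ← inv_div (π + 2 * θ) π, add_div, div_self hpi.ne', mul_div_assoc]
  have hB := one_add_mul_add_sq_le_pow hu.le s
  have hq : (s : ℝ) * ((s : ℝ) - 1) / 2 * u ^ 2 ≤ (1 + u) ^ s := by
    have : 0 ≤ 1 + (s : ℝ) * u := by positivity
    linarith
  have hqpos : 0 < (s : ℝ) * ((s : ℝ) - 1) / 2 * u ^ 2 := by
    have : 0 < (s : ℝ) * ((s : ℝ) - 1) := by nlinarith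
    positivity
  calc hpMode θ ^ s ≤ ((1 + u) ^ s)⁻¹ := h2 ▸ h1
    _ ≤ ((s : ℝ) * ((s : ℝ) - 1) / 2 * u ^ 2)⁻¹ := inv_anti₀ hqpos hq
    _ = π ^ 2 / (2 * (s : ℝ) * ((s : ℝ) - 1)) * (θ ^ 2)⁻¹ := by
        rw [hudef]; field_simp

/-- `∫ₐᵇ θ⁻² dθ = a⁻¹ - b⁻¹` for `0 < a ≤ b`. [folklore] -/
theorem integral_inv_sq {a b : ℝ} (ha : 0 < a) (hab : a ≤ b) :
    ∫ θ in a..b, (θ ^ 2)⁻¹ = a⁻¹ - b⁻¹ := by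
  have hderiv : ∀ x ∈ uIcc a b, HasDerivAt (fun y : ℝ => -y⁻¹) ((x ^ 2)⁻¹) x := by
    intro x hx
    rw [uIcc_of_le hab] at hx
    have hx0 : x ≠ 0 := (lt_of_lt_of_le ha hx.1).ne'
    have h := (hasDerivAt_inv hx0).neg
    rw [neg_neg] at h
    exact h
  have hcont : ContinuousOn (fun θ : ℝ => (θ ^ 2)⁻¹) (uIcc a b) := by
    refine ContinuousOn.inv₀ (continuousOn_pow 2) fun x hx => ?_
    rw [uIcc_of_le hab] at hx
    exact pow_ne_zero 2 (lt_of_lt_of_le ha hx.1).ne'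
  rw [integral_eq_sub_of_hasDerivAt hderiv (hcont.intervalIntegrable)]
  ring

/-- **`∫₀^π ρ^s ≤ 2π/s`** for `s ≥ 1`. [folklore] -/
theorem integral_hpMode_pow_le {s : ℕ} (hs : 1 ≤ s) :
    ∫ θ in (0 : ℝ)..π, hpMode θ ^ s ≤ 2 * π / s := by
  have hpi := Real.pi_pos
  have hs0 : (0 : ℝ) < s := by exact_mod_cast hs
  have hint : ∀ a b : ℝ, IntervalIntegrable (fun θ => hpMode θ ^ s) volume a b := fun a b =>
    (continuous_hpMode.pow s).intervalIntegrable _ _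
  have hle1 : ∀ θ, hpMode θ ^ s ≤ 1 := fun θ => pow_le_one₀ (hpMode_pos θ).le (hpMode_le_one θ)
  rcases Nat.lt_or_ge s 2 with hs1 | hs2
  · -- `s = 1`: the trivial bound `π ≤ 2π`
    have hs1' : s = 1 := by omega
    subst hs1'
    calc ∫ θ in (0 : ℝ)..π, hpMode θ ^ 1 ≤ ∫ θ in (0 : ℝ)..π, (1 : ℝ) :=
          integral_mono_on hpi.le (hint 0 π) intervalIntegrable_const fun θ _ => hle1 θ
      _ = π := by simp
      _ ≤ 2 * π / (1 : ℕ) := by simp; linarith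
  · have hs2' : (2 : ℝ) ≤ s := by exact_mod_cast hs2
    set θ₀ : ℝ := π / s with hθ₀
    have hθ₀pos : 0 < θ₀ := by positivity
    have hθ₀le : θ₀ ≤ π := by
      rw [hθ₀, div_le_iff₀ hs0]; nlinarith
    set C : ℝ := π ^ 2 / (2 * (s : ℝ) * ((s : ℝ) - 1)) with hC
    have hCpos : 0 < C := by
      have : 0 < (s : ℝ) - 1 := by linarith
      positivity
    rw [← integral_add_adjacent_intervals (hint 0 θ₀) (hint θ₀ π)]
    -- near `0`: bounded by `θ₀`
    have hI1 : ∫ θ in (0 : ℝ)..θ₀, hpMode θ ^ s ≤ θ₀ := by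
      calc ∫ θ in (0 : ℝ)..θ₀, hpMode θ ^ s ≤ ∫ θ in (0 : ℝ)..θ₀, (1 : ℝ) :=
            integral_mono_on hθ₀pos.le (hint 0 θ₀) intervalIntegrable_const fun θ _ => hle1 θ
        _ = θ₀ := by simp
    -- away from `0`: bounded by `C ∫ θ⁻²`
    have hcont : ContinuousOn (fun θ : ℝ => C * (θ ^ 2)⁻¹) (uIcc θ₀ π) := by
      refine continuousOn_const.mul (ContinuousOn.inv₀ (continuousOn_pow 2) fun x hx => ?_)
      rw [uIcc_of_le hθ₀le] at hx
      exact pow_ne_zero 2 (lt_of_lt_of_le hθ₀pos hx.1).ne'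
    have hI2 : ∫ θ in θ₀..π, hpMode θ ^ s ≤ C * (θ₀⁻¹ - π⁻¹) := by
      calc ∫ θ in θ₀..π, hpMode θ ^ s ≤ ∫ θ in θ₀..π, C * (θ ^ 2)⁻¹ :=
            integral_mono_on hθ₀le (hint θ₀ π) hcont.intervalIntegrable fun θ hθ =>
              hpMode_pow_le_div_sq (lt_of_lt_of_le hθ₀pos hθ.1) hθ.2 hs2
        _ = C * (θ₀⁻¹ - π⁻¹) := by
            rw [intervalIntegral.integral_const_mul, integral_inv_sq hθ₀pos hθ₀le]
    have hI2' : C * (θ₀⁻¹ - π⁻¹) ≤ π / s := by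
      have e1 : C * θ₀⁻¹ = π / (2 * ((s : ℝ) - 1)) := by
        rw [hC, hθ₀]; field_simp
      have h2 : π / (2 * ((s : ℝ) - 1)) ≤ π / s :=
        div_le_div_of_nonneg_left hpi.le hs0 (by linarith)
      have h3 : 0 ≤ C * π⁻¹ := by positivity
      nlinarith
    calc (∫ θ in (0 : ℝ)..θ₀, hpMode θ ^ s) + ∫ θ in θ₀..π, hpMode θ ^ s
        ≤ θ₀ + π / s := by linarith
      _ = 2 * π / s := by rw [hθ₀]; ring

/-- **(K) The half-plane kernel is `O(1/s)` uniformly in the horizontal variable**: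
`hpK s m ≤ 2/s` for `s ≥ 1` and every `m` (the harmonic measure of a single boundary point seen
from height `s - 1` is at most `2/s`, wherever the point). [folklore] -/
theorem hpK_le_two_div {s : ℕ} (hs : 1 ≤ s) (m : ℤ) : hpK s m ≤ 2 / s := by
  have hpi := Real.pi_pos
  have hs0 : (0 : ℝ) < s := by exact_mod_cast hs
  unfold hpK
  have hle : ∫ θ in (0 : ℝ)..π, Real.cos (m * θ) * hpMode θ ^ s ≤
      ∫ θ in (0 : ℝ)..π, hpMode θ ^ s :=
    integral_mono_on hpi.le ((continuous_cos_mul_hpMode_pow s m).intervalIntegrable _ _)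
      ((continuous_hpMode.pow s).intervalIntegrable _ _) fun θ _ => by
        have h1 := Real.cos_le_one (m * θ)
        have h2 : 0 ≤ hpMode θ ^ s := pow_nonneg (hpMode_pos θ).le s
        nlinarith
  calc π⁻¹ * ∫ θ in (0 : ℝ)..π, Real.cos (m * θ) * hpMode θ ^ s
      ≤ π⁻¹ * (2 * π / s) :=
        mul_le_mul_of_nonneg_left (hle.trans (integral_hpMode_pow_le hs)) (inv_nonneg.2 hpi.le)
    _ = 2 / s := by field_simp

/-- **(K) on the lattice**: `hpPoisson (m, j) ≤ 2/(j+1)` for `j ≥ 0`. [folklore] -/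
theorem hpPoisson_le_two_div (v : Site 2) (h1 : 0 ≤ v 1) :
    hpPoisson v ≤ 2 / ((v 1 : ℝ) + 1) := by
  rw [hpPoisson]
  have hs : 1 ≤ (v 1 + 1).toNat := by omega
  have hcast : (((v 1 + 1).toNat : ℕ) : ℝ) = (v 1 : ℝ) + 1 := by
    have : (((v 1 + 1).toNat : ℕ) : ℤ) = v 1 + 1 := Int.toNat_of_nonneg (by omega)
    exact_mod_cast this
  have := hpK_le_two_div hs (v 0)
  rw [hcast] at this
  exact this

/-! ### The two outer boundaries of the tree agree -/

/-- A point of the `Pi.single`-phrased outer boundary `zdOuterBoundary` lies in the graph outer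
boundary `outerBoundary (zdGraph d)`. [folklore] -/
theorem mem_outerBoundary_of_mem_zdOuterBoundary {d : ℕ} {Λ : Finset (Site d)} {z : Site d}
    (hz : z ∈ zdOuterBoundary (↑Λ : Set (Site d))) : z ∈ outerBoundary (zdGraph d) Λ := by
  obtain ⟨hzΛ, x, hx, i, h⟩ := hz
  refine mem_outerBoundary_iff.2 ⟨hzΛ, x, hx, (zdGraph_adj_iff z x).2 ⟨i, ?_⟩⟩
  rcases h with h | h
  · exact Or.inr h
  · left; rw [h, sub_add_cancel]

/-! ### (P) Green function at a boundary-row point vs the half-plane kernel -/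

/-- The translated half-plane kernel `v ↦ hpPoisson (v - p)` (pole at `p - e₂`) is harmonic in
the rows `{v₁ ≥ p₁}`. [folklore] -/
theorem latticeLaplacianZd_hpPoisson_sub {p v : Site 2} (hv : p 1 ≤ v 1) :
    latticeLaplacianZd (fun w => hpPoisson (w - p)) v = 0 := by
  have h := latticeLaplacianZd_comp_add hpPoisson (-p) v
  simp only [← sub_eq_add_neg] at h
  rw [h, ← latticeLaplacian_eq_latticeLaplacianZd]
  exact latticeLaplacian_hpPoisson (by simp; omega)

/-- The translated kernel on the row `p₁ - 1` is the indicator of `p - e₂`. [folklore] -/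
theorem hpPoisson_sub_row {p z : Site 2} (hz : z 1 = p 1 - 1) :
    hpPoisson (z - p) = if z = p - Pi.single 1 1 then 1 else 0 := by
  rw [hpPoisson_row_neg_one _ (by simp; omega)]
  have hc := (neighbour_coords p).2.2.2
  by_cases h : z = p - Pi.single 1 1
  · rw [if_pos h, if_pos]
    rw [h]; simp
  · rw [if_neg h, if_neg]
    intro h0
    apply h
    funext i; fin_cases i
    · simp at h0; simp [hc.1]; linarith
    · simp [hc.2]; omega

section Compare

variable {Λ : Finset (Site 2)} {p : Site 2} (hΛ : ∀ v ∈ Λ, p 1 ≤ v 1)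
include hΛ

/-- The outer vertex `p̂ = p - e₂` below a lowest-row point is outside `Λ`. [folklore] -/
theorem below_not_mem : p - Pi.single 1 1 ∉ Λ := fun h => by
  have := hΛ _ h
  simp at this

/-- **Green function at a lowest-row point = harmonic measure of the outer vertex below it**:
for `Λ` in the rows `{v₁ ≥ p₁}`, `G_Λ(v, p) = H_Λ(v, p - e₂)` (the only neighbour of `p - e₂`
in `Λ` is `p`). [folklore] -/
theorem dirichletGreen_eq_poissonKernel_below (v : Site 2) :
    dirichletGreen Λ v p = poissonKernel Λ v (p - Pi.single 1 1) := by
  symm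
  refine poissonKernel_eq_dirichletGreen_of_unique Λ v (below_not_mem hΛ) ?_ ?_
  · exact (zdGraph_adj_iff _ _).2 ⟨1, Or.inl (by rw [sub_add_cancel])⟩
  · intro w hw hwΛ
    have h1 := hΛ w hwΛ
    have hc := (neighbour_coords p).2.2.2
    rcases (adj_iff_coords _ w).1 hw with h | h | h | h
    · omega
    · omega
    · funext i; fin_cases i
      · simpa [hc.1] using h.1
      · have := h.2; simp at this; simpa using this
    · omega

/-- The corrected Green function `G_Λ(·, p) + 1_{p̂}` is harmonic on `Λ` (the indicator supplies
the missing boundary value `1` at `p̂`, whose only neighbour in `Λ` is the pole `p`). [folklore] -/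
theorem latticeLaplacianZd_green_add_indicator {v : Site 2} (hv : v ∈ Λ) :
    latticeLaplacianZd (fun w => dirichletGreen Λ w p +
      (if w = p - Pi.single 1 1 then (1 : ℝ) else 0)) v = 0 := by
  have hd : 0 < 2 := by norm_num
  rw [show (fun w => dirichletGreen Λ w p + (if w = p - Pi.single 1 1 then (1 : ℝ) else 0)) =
    (fun w => dirichletGreen Λ w p) + (fun w => if w = p - Pi.single 1 1 then (1 : ℝ) else 0)
    from rfl, latticeLaplacianZd_add]
  have h1 : latticeLaplacianZd (fun w => dirichletGreen Λ w p) v = -(if p = v then 1 else 0) := by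
    have e : (fun w => dirichletGreen Λ w p) = dirichletGreen Λ p := by
      funext w; exact dirichletGreen_comm Λ w p
    rw [e]
    have := neg_latticeLaplacianZd_dirichletGreen hd Λ p hv
    linarith
  have hpv := hΛ v hv
  have hph := below_not_mem hΛ
  obtain ⟨⟨-, a1⟩, ⟨-, b1⟩, ⟨-, c1⟩, -⟩ := neighbour_coords v
  have hc := (neighbour_coords p).2.2.2
  -- which neighbours of `v` can be `p̂`: only `v - e₂`, and then `v = p`
  have n1 : v + Pi.single 0 1 ≠ p - Pi.single 1 1 := fun h => by
    have := congrFun h 1; rw [a1, hc.2] at this; omega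
  have n2 : v - Pi.single 0 1 ≠ p - Pi.single 1 1 := fun h => by
    have := congrFun h 1; rw [b1, hc.2] at this; omega
  have n3 : v + Pi.single 1 1 ≠ p - Pi.single 1 1 := fun h => by
    have := congrFun h 1; rw [c1, hc.2] at this; omega
  have n0 : v ≠ p - Pi.single 1 1 := fun h => hph (h ▸ hv)
  have h4 : (v - Pi.single 1 1 = p - Pi.single 1 1) ↔ p = v := by
    constructor
    · intro h; exact (sub_left_inj.1 h).symm
    · rintro rfl; rfl
  have h2 : latticeLaplacianZd (fun w => if w = p - Pi.single 1 1 then (1 : ℝ) else 0) v =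
      if p = v then 1 else 0 := by
    rw [latticeLaplacianZd_two]
    simp only [if_neg n1, if_neg n2, if_neg n3, if_neg n0]
    by_cases hpv' : p = v
    · rw [if_pos (h4.2 hpv'), if_pos hpv']; ring
    · rw [if_neg (fun h => hpv' (h4.1 h)), if_neg hpv']; ring
  rw [h1, h2]; ring

/-- The comparison function `hpPoisson(· - p) - (G_Λ(·,p) + 1_{p̂})` is harmonic on `Λ`.
[folklore] -/
theorem isZdHarmonicOn_hpPoisson_sub_green :
    IsZdHarmonicOn ((fun w => hpPoisson (w - p)) - fun w => dirichletGreen Λ w p +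
      (if w = p - Pi.single 1 1 then (1 : ℝ) else 0)) ↑Λ := by
  intro w hw
  rw [latticeLaplacianZd_sub, latticeLaplacianZd_hpPoisson_sub (hΛ w hw),
    latticeLaplacianZd_green_add_indicator hΛ hw, sub_zero]

/-- **(P, upper) The half-plane kernel dominates the Green function at a lowest-row point**:
`G_Λ(v, p) ≤ hpPoisson(v - p)` for `Λ ⊆ {v₁ ≥ p₁}` (the walk exiting `Λ` at `p̂` exits the
half-plane at `p̂`; minimum principle for `hpPoisson(· - p) - G_Λ(·,p) - 1_{p̂}`). [folklore] -/
theorem dirichletGreen_le_hpPoisson (v : Site 2) : dirichletGreen Λ v p ≤ hpPoisson (v - p) := by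
  have hd : 0 < 2 := by norm_num
  by_cases hv : v ∈ Λ
  · have hsuper := (isZdHarmonicOn_hpPoisson_sub_green hΛ).superharmonicOn
    have hbd : ∀ z ∈ zdOuterBoundary (↑Λ : Set (Site 2)),
        (0 : ℝ) ≤ ((fun w => hpPoisson (w - p)) - fun w => dirichletGreen Λ w p +
          (if w = p - Pi.single 1 1 then (1 : ℝ) else 0)) z := by
      intro z hz
      have hzΛ : z ∉ Λ := fun h => hz.1 h
      simp only [Pi.sub_apply, dirichletGreen_of_not_mem_left Λ hzΛ, zero_add]
      by_cases hzp : z = p - Pi.single 1 1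
      · rw [if_pos hzp, hzp, hpPoisson_sub_row (by simp), if_pos rfl, sub_self]
      · rw [if_neg hzp, sub_zero]; exact hpPoisson_nonneg _
    have key := hsuper.ge_of_forall_boundary_ge hd Λ.finite_toSet hbd v hv
    have hvp : v ≠ p - Pi.single 1 1 := fun h => below_not_mem hΛ (h ▸ hv)
    simp only [Pi.sub_apply, if_neg hvp, add_zero, sub_nonneg] at key
    exact key
  · rw [dirichletGreen_of_not_mem_left Λ hv]; exact hpPoisson_nonneg _

/-- **(P, lower) The Green function at a lowest-row point dominates the half-plane kernel up to
the kernel's size on the far boundary**: if `hpPoisson(z - p) ≤ B` for every `z ∈ ∂Λ` in the rows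
`{z₁ ≥ p₁}` (on the row `p₁ - 1` the kernel vanishes off `p̂`), then
`hpPoisson(v - p) - B ≤ G_Λ(v, p)` on `Λ`. [folklore] -/
theorem hpPoisson_sub_le_dirichletGreen {B : ℝ} (hB0 : 0 ≤ B)
    (hB : ∀ z ∈ outerBoundary (zdGraph 2) Λ, p 1 ≤ z 1 → hpPoisson (z - p) ≤ B)
    {v : Site 2} (hv : v ∈ Λ) : hpPoisson (v - p) - B ≤ dirichletGreen Λ v p := by
  have hd : 0 < 2 := by norm_num
  have hsub := (isZdHarmonicOn_hpPoisson_sub_green hΛ).subharmonicOn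
  have hbd : ∀ z ∈ zdOuterBoundary (↑Λ : Set (Site 2)),
      ((fun w => hpPoisson (w - p)) - fun w => dirichletGreen Λ w p +
        (if w = p - Pi.single 1 1 then (1 : ℝ) else 0)) z ≤ B := by
    intro z hz
    have hz' := mem_outerBoundary_of_mem_zdOuterBoundary hz
    have hzΛ : z ∉ Λ := fun h => hz.1 h
    obtain ⟨-, x, hx, hadj⟩ := mem_outerBoundary_iff.1 hz'
    have hx1 := hΛ x hx
    simp only [Pi.sub_apply, dirichletGreen_of_not_mem_left Λ hzΛ, zero_add]
    by_cases hrow : z 1 = p 1 - 1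
    · rw [hpPoisson_sub_row hrow]
      split_ifs <;> linarith
    · have hz1 : p 1 ≤ z 1 := by
        rcases (adj_iff_coords z x).1 hadj with h | h | h | h <;> omega
      have hzp : z ≠ p - Pi.single 1 1 := fun h => by
        rw [h] at hz1; simp at hz1
      rw [if_neg hzp, sub_zero]
      exact hB z hz' hz1
  have key := hsub.le_of_forall_boundary_le hd Λ.finite_toSet hbd v hv
  have hvp : v ≠ p - Pi.single 1 1 := fun h => below_not_mem hΛ (h ▸ hv)
  simp only [Pi.sub_apply, if_neg hvp, add_zero] at key
  linarith

end Compare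

/-! ### Registered sub-goal of the stub carried by this file -/

/-- **Sub-goal `s10_halfPlaneKernelDecay`** (registered on stmt-CriticalPhenomena-14132; step (K)
of the Green-locality half G1 of `stub_clusterLocalityV2`): the Poisson kernel of the discrete
upper half-plane read at height `s - 1` is at most `2/s`, uniformly in the horizontal variable
(`hpK_le_two_div`). [folklore] -/
theorem s10_halfPlaneKernelDecay : ∀ (s : ℕ) (m : ℤ), 1 ≤ s → Literature.Probability.LatticeModels.hpK s m ≤ 2 / (s : ℝ) :=
  fun _ m hs => hpK_le_two_div hs m

end Summit.CriticalPhenomena.CardyFormulaZ2.Cruxes.BoundaryDefectGaussianR.RainbowMonomialsInExcursionKernels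

end
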